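import Summits.ResolutionOfSingularities.ResolutionOfSingularities.Theorems.PurelyInseparableDim4ChartAtlasSNCRepairGlobal
import Summits.ResolutionOfSingularities.ResolutionOfSingularities.Theorems.PurelyInseparableDim4JointWaitingMember
import Literature.AlgebraicGeometry.Hironaka2017.Lib.AffineCoordBlowupLSB
import HarnessLib

/-!
# The S3-N2 REPAIR on the chart model: after blowing up `Σ`, the strict transform of the escaping centre is an ADMISSIBLE BGMW centre
# — regular, inside the support of the transformed marked ideal, snc with the transformed boundary (cell `res-dim4-pi`, typ-2 g5)

[OURS · counted 0 · about OUR S3 (c) strategy; nothing about resolution of singularities] (D-0157 DOOR 2; DR-157-C; desk WORD #131 (c);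
crit-3 g4 K-A3-26b/30 riders r3/r4). CAPSTONE of N3–N7 on the chart-`x_l` MODEL `𝔸⁵_K`: marked ideal `M = ((z^p + F)·𝒪, E, p)` with `F`
`T`-permissible (`p ≤ ord_{(x_T)} F`, e.g. `F = F_l` of the S3-N1 atlas), boundary `E = x_j·𝒪 :: (x_m + b·x_j)·𝒪 :: [(xᵢ + cᵢ)·𝒪 : i ∈ l]`
containing the BAD PAIR (`m ∈ T`, `j ∉ T`, `b ≠ 0`; `l ∌ m, j`; `c = 0` on `T`) — so that the escaping centre `V(z, x_T)` is NOT admissible for `M`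
(p690374) —, `Σ = 𝓘Λ_{insert j T}`, `π' : W' → 𝔸⁵` ANY blowing up along `Σ`, `M' = M.transform π' Σ`, `C' = St_{π'} 𝓘Λ_T`. PROVED here
(no `sorry`, no new axiom):

* `comap_chartImm_transform_ideal_model` — `M'.ideal` reads `(z^p + chartTransform p (insert j T) j F)·𝒪` on the `x_j`-chart;
* **`admissible_strictTransform_after_repair`** — `V(C')` is REGULAR, `V(C') ⊆ supp M'`, and `HasSNCWith M'.boundary C'`: AFTER THE EXTRA
  BLOW-UP OF `Σ = closure ∖ image` THE STRICT TRANSFORM OF THE ESCAPING CENTRE IS AN ADMISSIBLE CENTRE (BGMW Def. 3.1.3 (1)–(2)) for the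
  transformed marked ideal.

(`Σ` itself is admissible for `M`: regular coordinate subspace, `Σ ⊂ V(z, x_T) ⊆ supp M`, snc with `E` by N3 `hasSNCWith_pair_translatedHyperplanes_𝓘Λ_insert`.)
HONEST SCOPE: the chart MODEL (constant-translated further members); transporting the two-step repair to the actual stage `W₁ ⊃ Zc` of the
walk is typ-3's v3 assembly (zigzag charts); COST of the extra blow-up for the termination measure unbooked (planner). Resolution of
singularities in dimension ≥ 4 / characteristic `p` is NOT proved anywhere in this programme. bears_on: LADDER-RESOLUTION:D157-DOOR2
(res-dim4-pi). Supports stmt-ResolutionOfSingularities-16155 (helper, S3-N2 repair admissibility on the model).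
-/

-- every declaration of this summit lives under `Summit.ResolutionOfSingularities.ResolutionOfSingularities`
-- (summit = problem), which the duplicate-namespace linter flags; house convention (cf. the Target file).
set_option linter.dupNamespace false

noncomputable section

open MvPolynomial Finset CategoryTheory AlgebraicGeometry Opposite TopologicalSpace
open AlgebraicGeometry.Scheme.IdealSheafData (ofIdealTop vanishingIdeal)

namespace Summit.ResolutionOfSingularities.ResolutionOfSingularities.Theorems.PIDim4

open Literature.AlgebraicGeometry.Resolution
open Literature.AlgebraicGeometry.Resolution.AffinePointBlowup (P A γ coord Wtop ξ)

namespace ChartDictionary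

variable {K : Type} [Field K] {p : ℕ} {S T : Finset (Fin 4)} {j m : Fin 4} {b : K}
  {W : Scheme.{0}} {π : W ⟶ P 4 K}

/-- On the `x_j`-chart of ANY blowing up of `𝔸⁵` along `V(z, x_S)` (`j ∈ S`, `p ≤ ord_{(x_S)} F`) the transform of the marked ideal
`((z^p + F)·𝒪, E, p)` reads `(z^p + chartTransform p S j F)·𝒪` (the tree's chart transfer, marked-ideal dress). -/
theorem comap_chartImm_transform_ideal_model (hj : j ∈ S) (F : MvPolynomial (Fin 4) K) (hperm : (p : ℕ∞) ≤ CentreBlowup.ordAlong S F)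
    (E : List (P 4 K).IdealSheafData) (hπ : IsBlowup π (AffineCoordBlowup.𝓘Λ 4 K (insert 0 (Fin.succ '' (S : Set (Fin 4)))))) :
    (((⟨hypSheaf p F, E, p⟩ : MarkedIdeal (P 4 K)).transform π
        (AffineCoordBlowup.𝓘Λ 4 K (insert 0 (Fin.succ '' (S : Set (Fin 4)))))).ideal).comap
        (AffineCoordBlowup.chartImm hπ (succ_mem_centreVars hj)) =
      hypSheaf p (CentreBlowup.chartTransform p S j F) := by
  rw [MarkedIdeal.transform_ideal]
  exact controlledTransform_comap_chartImm p hj F hperm hπ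

/-- **AFTER THE REPAIR BLOW-UP THE STRICT TRANSFORM OF THE ESCAPING CENTRE IS ADMISSIBLE** (chart model). See the module docstring. -/
theorem admissible_strictTransform_after_repair (hmT : m ∈ T) (hjT : j ∉ T) (hb : b ≠ 0) (l : List (Fin 4)) (hml : m ∉ l) (hjl : j ∉ l)
    (c : Fin 4 → K) (hc : ∀ i ∈ T, c i = 0) (F : MvPolynomial (Fin 4) K) (hperm : (p : ℕ∞) ≤ CentreBlowup.ordAlong T F)
    (hπ : IsBlowup π (AffineCoordBlowup.𝓘Λ 4 K (insert 0 (Fin.succ '' ((insert j T : Finset (Fin 4)) : Set (Fin 4)))))) :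
    let E : List (P 4 K).IdealSheafData := ofIdealTop (Ideal.span {(γ 4 K).symm (X j.succ)}) ::
      ofIdealTop (Ideal.span {(γ 4 K).symm (X m.succ + C b * X j.succ)}) ::
      l.map fun i => ofIdealTop (Ideal.span {(γ 4 K).symm (X i.succ + C (c i))})
    let M' := ((⟨hypSheaf p F, E, p⟩ : MarkedIdeal (P 4 K)).transform π
      (AffineCoordBlowup.𝓘Λ 4 K (insert 0 (Fin.succ '' ((insert j T : Finset (Fin 4)) : Set (Fin 4))))))
    let C' := strictTransformIdeal π (AffineCoordBlowup.𝓘Λ 4 K (insert 0 (Fin.succ '' ((insert j T : Finset (Fin 4)) : Set (Fin 4)))))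
      (AffineCoordBlowup.𝓘Λ 4 K (insert 0 (Fin.succ '' (T : Set (Fin 4)))))
    Scheme.IsRegular C'.subscheme ∧ (C'.support : Set W) ⊆ M'.support ∧ HasSNCWith M'.boundary C' := by
  intro E M' C'
  haveI : IsProper π := hπ.isProper
  haveI : IsLocallyNoetherian W := LocallyOfFiniteType.isLocallyNoetherian π
  have hj' : j ∈ insert j T := Finset.mem_insert_self j T
  set Λ : Set (Fin (4 + 1)) := insert 0 (Fin.succ '' ((insert j T : Finset (Fin 4)) : Set (Fin 4))) with hΛ
  set ΛT : Set (Fin (4 + 1)) := insert 0 (Fin.succ '' (T : Set (Fin 4))) with hΛT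
  have hsub : ΛT ⊆ Λ := by
    refine Set.insert_subset_insert (Set.image_mono ?_)
    rw [Finset.coe_insert]; exact Set.subset_insert _ _
  have hjΛT : j.succ ∉ ΛT := fun h => hjT ((succ_mem_centreVars_iff T j).mp h)
  have hΛle : Λ ⊆ insert j.succ ΛT := by
    rintro i (rfl | ⟨k, hk, rfl⟩)
    · exact Set.mem_insert_of_mem _ (Set.mem_insert _ _)
    · rw [Finset.coe_insert] at hk
      rcases hk with rfl | hk
      · exact Set.mem_insert _ _
      · exact Set.mem_insert_of_mem _ (Set.mem_insert_of_mem _ ⟨k, hk, rfl⟩)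
  -- the single chart `x_j` covers `V(C')`, and `C'` reads `𝓘Λ_T` there
  have hcov : (C'.support : Set W) ⊆ ⋃ _ : Unit, Set.range (AffineCoordBlowup.chartImm hπ (succ_mem_centreVars hj')) := fun w hw =>
    Set.mem_iUnion.mpr ⟨(), support_strictTransformIdeal_𝓘Λ_subset_opensRange hπ hsub (succ_mem_centreVars hj') hΛle hw⟩
  have hread : C'.comap (AffineCoordBlowup.chartImm hπ (succ_mem_centreVars hj')) = AffineCoordBlowup.𝓘Λ 4 K ΛT :=
    comap_chartImm_strictTransformIdeal_𝓘Λ_of_subset hπ hsub (succ_mem_centreVars hj') hjΛT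
  -- permissibility downstairs for `Σ` and on the chart for `T`
  have hpermIns : (p : ℕ∞) ≤ CentreBlowup.ordAlong (insert j T) F :=
    hperm.trans (CentreBlowup.ordAlong_mono (Finset.subset_insert j T) F)
  have hperm' : (p : ℕ∞) ≤ CentreBlowup.ordAlong T (CentreBlowup.chartTransform p (insert j T) j F) :=
    (Equimultiple.isPermissibleCentre_chartTransform_of_not_mem p p (insert j T) hjT (P := F) ⟨⟨m, hmT⟩, hperm⟩).2
  refine ⟨?_, ?_, ?_⟩
  · -- regular
    refine isRegular_subscheme_of_cover_comap (fun _ : Unit => AffineCoordBlowup.chartImm hπ (succ_mem_centreVars hj')) hcov fun _ => ?_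
    rw [hread]
    exact Literature.AlgebraicGeometry.Hironaka2017.Lib.AffineCoordBlowupLSB.isRegular_CΛ 4 K ΛT
  · -- inside the support
    refine support_subset_of_cover_comap (fun _ : Unit => AffineCoordBlowup.chartImm hπ (succ_mem_centreVars hj')) hcov fun _ => ?_
    intro y hy
    rw [hread, AffineCoordBlowup.support_𝓘Λ] at hy
    change (AffineCoordBlowup.chartImm hπ (succ_mem_centreVars hj')) y ∈ M'.support
    change ((M'.mult : ℕ) : ℕ∞) ≤ idealOrder M'.ideal _
    rw [MarkedIdeal.transform_mult, ← idealOrder_comap_of_isOpenImmersion (AffineCoordBlowup.chartImm hπ (succ_mem_centreVars hj')),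
      comap_chartImm_transform_ideal_model hj' F hpermIns E hπ]
    exact le_idealOrder_hypSheaf_of_mem_CΛ p T _ hperm' hy
  · -- snc with the transformed boundary
    rw [MarkedIdeal.transform_boundary]
    exact hasSNCWith_transform_boundary_strictTransform_after_repair hmT hjT hb l hml hjl c hc hπ

end ChartDictionary

end Summit.ResolutionOfSingularities.ResolutionOfSingularities.Theorems.PIDim4

end
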